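import Mathlib.MeasureTheory.Measure.Haar.Basic
import Mathlib.MeasureTheory.Integral.Bochner.Basic
import Mathlib.MeasureTheory.Integral.Bochner.Set
import Mathlib.MeasureTheory.Group.Integral
import Mathlib.Topology.Algebra.Nonarchimedean.Basic
import Mathlib.Topology.LocallyConstant.Basic
import Literature.NumberTheory.Automorphic.TateLocalFactors
import Literature.NumberTheory.Automorphic.SmoothRepresentationIrreducibleContragredientProofs
import Literature.NumberTheory.Automorphic.MatrixCoefficientsProofs
import HarnessLib

/-!
# Schwartz–Bruhat (test) functions on a totally disconnected group and the smeared functionals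
`Λ ⋆ φ`

Topic `NumberTheory/Automorphic`. Support file (definitions with bodies and proved theorems only;
no named fact) for the Gelfand–Kazhdan criterion of `WhittakerModelsGelfandKazhdan`, in the
generality of a topological group `G` (locally compact and nonarchimedean where needed). The space
of test functions is the tree's `SchwartzBruhat G : Submodule ℂ (G → ℂ)` (`TateLocalFactors`:
locally constant, compactly supported functions; Bump 1997, §4.3, p. 435 writes `C_c^∞(G)`;
Bernstein–Zelevinsky 1976, §1); its algebraic dual `Module.Dual ℂ (SchwartzBruhat G)` is the space
`𝔇(G)` of distributions ("there is no assumption that the functional be continuous", Bump, loc.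
cit.). This file adds:

* `SchwartzBruhat.leftTranslate a` = `λ(a)`, `(λ(a) f)(x) = f(a⁻¹ x)`, and
  `SchwartzBruhat.rightTranslate a` = `ρ(a)`, `(ρ(a) f)(x) = f(x a)` — Bump's conventions (3.4),
  p. 435 — with `mul_mem_schwartzBruhat`, `comp_inv_mem_schwartzBruhat`,
  `indicator_mem_schwartzBruhat`.
* `exists_isCompact_isOpen_forall_mul_right_eq`, `exists_isCompact_isOpen_forall_mul_eq(₂)` —
  **uniform local constancy**: a test function is bi-invariant under a compact open subgroup.
* `exists_finset_quotient_of_hasCompactSupport`, `integral_mul_eq_finset_sum` — the support of a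
  right-`K`-invariant test function meets finitely many cosets `x K`, and against any
  right-`K`-invariant `Φ` its integral is the **finite coset sum** `μ(K) ∑ f(xᵢ) Φ(xᵢ)`. This is the
  device by which a distribution is evaluated "inside an integral" (Bump 1997, pp. 458–459,
  passage from (4.14) to (4.16)) without any continuity of the distribution.
* `Representation.IsSmooth.smear μ Λ : SchwartzBruhat G →ₗ[ℂ] Module.Dual ℂ V` — for a smooth
  representation `(π, V)` and ANY linear form `Λ` on `V`, Bump's smeared functional
  `(Λ ⋆ φ)(ξ) = ∫_G φ(g) Λ(π(g) ξ) dg` ((4.9), p. 458: "even if `Λ` is not smooth, the integrand is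
  smooth and compactly supported"), with: `smear_apply_apply_apply` / `dual_smear`
  (`π^*(a)(Λ ⋆ φ) = Λ ⋆ ρ(a) φ`, the computation behind (4.10); needs a right invariant measure),
  `smear_mem_contragredient` (`Λ ⋆ φ` is smooth), `smear_leftTranslate` ((4.12):
  `Λ ⋆ λ(u) φ = c (Λ ⋆ φ)` when `Λ ∘ π(u) = c Λ`), `smear_rightTranslate_eq_zero`, and the
  bump-function computation `smear_indicator_apply` (`(Λ ⋆ 1_K)(ξ) = μ(K) Λ(ξ)` if `K` fixes `ξ`,
  p. 459).

## Design notes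

* The Hecke *algebra* structure of `C_c^∞(G)` (convolution) and the operators `π(φ)` on `V` are
  deliberately NOT introduced: the criterion only needs `Λ ⋆ φ`, finite coset sums, and
  translations. (`HeckeAlgebra.lean` treats the level-`K` Hecke algebras.)
* Measures are Mathlib measures with the invariance actually used as instance hypotheses
  (`IsMulLeftInvariant`, `IsMulRightInvariant`, `IsFiniteMeasureOnCompacts`); unimodularity of
  `GL_n(F)` is proved in `GLnGelfandKazhdanInvolution`.
* `Representation.IsSmooth.smear` and its lemmas are deliberate dot-notation extensions of the
  tree's `Representation.IsSmooth` (file `SmoothRepresentation`), declared in Mathlib's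
  `Representation` namespace like `Representation.IsSmooth.exists_fixedPoints_projection`.

## References

* D. Bump, *Automorphic Forms and Representations*, Cambridge Stud. Adv. Math. 55 (1997), §4.3
  (p. 435: `C_c^∞`, distributions, (3.3)–(3.5)) and §4.4, pp. 457–459 ((4.9)–(4.12)). Page numbers
  of the held copy. [Bump1997]
* I. N. Bernstein, A. V. Zelevinsky, Russian Math. Surveys 31:3 (1976), 1–68, §1 (l-spaces,
  distributions) and §2 (smooth representations). [BernsteinZelevinskyRMS1976]
-/

open MeasureTheory MeasureTheory.Measure Topology
open scoped NNReal ENNReal Pointwise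

namespace Literature.NumberTheory.Automorphic

/-! ### Test functions `C_c^∞(G) = 𝒮(G)` on a totally disconnected group: translations -/

section TestFunctions

variable {G : Type*} [TopologicalSpace G]

/-- A test function times a locally constant function is a test function. [folklore] -/
lemma mul_mem_schwartzBruhat {f Φ : G → ℂ} (hf : f ∈ SchwartzBruhat G) (hΦ : IsLocallyConstant Φ) :
    (fun x => f x * Φ x) ∈ SchwartzBruhat G :=
  ⟨hf.1.mul hΦ, hf.2.mul_right⟩

variable [Group G] [IsTopologicalGroup G]

/-- **Left translation** `(λ(a) f)(x) = f(a⁻¹ x)` of test functions (Bump 1997, (3.4), p. 435).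
[cite: Bump1997, (3.4), p. 435] -/
def SchwartzBruhat.leftTranslate (a : G) : SchwartzBruhat G →ₗ[ℂ] SchwartzBruhat G where
  toFun f := ⟨fun x => (f : G → ℂ) (a⁻¹ * x),
    ⟨f.2.1.comp_continuous (continuous_const.mul continuous_id),
      f.2.2.comp_homeomorph (Homeomorph.mulLeft a⁻¹)⟩⟩
  map_add' _ _ := rfl
  map_smul' _ _ := rfl

/-- **Right translation** `(ρ(a) f)(x) = f(x a)` of test functions (Bump 1997, (3.4), p. 435).
[cite: Bump1997, (3.4), p. 435] -/
def SchwartzBruhat.rightTranslate (a : G) : SchwartzBruhat G →ₗ[ℂ] SchwartzBruhat G where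
  toFun f := ⟨fun x => (f : G → ℂ) (x * a),
    ⟨f.2.1.comp_continuous (continuous_id.mul continuous_const),
      f.2.2.comp_homeomorph (Homeomorph.mulRight a)⟩⟩
  map_add' _ _ := rfl
  map_smul' _ _ := rfl

/-- Unfolding lemma for `SchwartzBruhat.leftTranslate`. [folklore] -/
@[simp] lemma SchwartzBruhat.leftTranslate_apply (a : G) (f : SchwartzBruhat G) (x : G) :
    (SchwartzBruhat.leftTranslate a f : G → ℂ) x = (f : G → ℂ) (a⁻¹ * x) := rfl

/-- Unfolding lemma for `SchwartzBruhat.rightTranslate`. [folklore] -/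
@[simp] lemma SchwartzBruhat.rightTranslate_apply (a : G) (f : SchwartzBruhat G) (x : G) :
    (SchwartzBruhat.rightTranslate a f : G → ℂ) x = (f : G → ℂ) (x * a) := rfl

/-- `ρ(a b) = ρ(a) ∘ ρ(b)` on test functions. [folklore] -/
lemma SchwartzBruhat.rightTranslate_mul (a b : G) (f : SchwartzBruhat G) :
    SchwartzBruhat.rightTranslate (a * b) f =
      SchwartzBruhat.rightTranslate a (SchwartzBruhat.rightTranslate b f) := by
  apply Subtype.ext; funext x
  simp only [SchwartzBruhat.rightTranslate_apply, mul_assoc]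

/-- `λ(a b) = λ(a) ∘ λ(b)` on test functions. [folklore] -/
lemma SchwartzBruhat.leftTranslate_mul (a b : G) (f : SchwartzBruhat G) :
    SchwartzBruhat.leftTranslate (a * b) f =
      SchwartzBruhat.leftTranslate a (SchwartzBruhat.leftTranslate b f) := by
  apply Subtype.ext; funext x
  simp only [SchwartzBruhat.leftTranslate_apply, _root_.mul_inv_rev, mul_assoc]

end TestFunctions

section Nonarchimedean

variable {G : Type*} [TopologicalSpace G] [Group G] [NonarchimedeanGroup G] [LocallyCompactSpace G]

/-- **Uniform local constancy on the right**: a test function on a locally compact nonarchimedean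
group is right-invariant under some compact open subgroup. (Bump 1997, §4.2–4.3;
Bernstein–Zelevinsky 1976, §1.) [folklore] -/
theorem exists_isCompact_isOpen_forall_mul_right_eq
    {f : G → ℂ} (hf : f ∈ SchwartzBruhat G) :
    ∃ K : Subgroup G, IsOpen (K : Set G) ∧ IsCompact (K : Set G) ∧
      ∀ k ∈ K, ∀ x, f (x * k) = f x := by
  obtain ⟨K₀, hK₀⟩ := exists_isCompact_openSubgroup (G := G)
  -- for each `x`, a compact open subgroup `W x ≤ K₀` with `f` constant on `x W x`
  have hW : ∀ x : G, ∃ W : Subgroup G, IsOpen (W : Set G) ∧ W ≤ (K₀ : Subgroup G) ∧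
      ∀ w ∈ W, f (x * w) = f x := by
    intro x
    obtain ⟨U, hU, hxU, hUf⟩ := hf.1.exists_open x
    have hnhds : (fun w => x * w) ⁻¹' U ∈ 𝓝 (1 : G) :=
      (continuous_const.mul continuous_id).continuousAt.preimage_mem_nhds
        (by simpa using hU.mem_nhds hxU)
    obtain ⟨V, hV⟩ := NonarchimedeanGroup.is_nonarchimedean _ hnhds
    refine ⟨(V : Subgroup G) ⊓ (K₀ : Subgroup G), ?_, inf_le_right, fun w hw => hUf _ (hV hw.1)⟩
    exact V.isOpen.inter K₀.isOpen
  choose W hWo hWle hWf using hW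
  -- finite subcover of the support by the open sets `x W x`
  have hcov : tsupport f ⊆ ⋃ x : G, (fun w => x * w) '' (W x : Set G) := by
    intro x _
    exact Set.mem_iUnion.2 ⟨x, 1, (W x).one_mem, mul_one x⟩
  obtain ⟨t, ht⟩ := hf.2.elim_finite_subcover (fun x => (fun w => x * w) '' (W x : Set G))
    (fun x => (isOpenMap_mul_left x) _ (hWo x)) hcov
  have hopen : IsOpen (((K₀ : Subgroup G) ⊓ ⨅ x ∈ t, W x : Subgroup G) : Set G) := by
    have : (((K₀ : Subgroup G) ⊓ ⨅ x ∈ t, W x : Subgroup G) : Set G) =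
        (K₀ : Set G) ∩ ⋂ x ∈ t, (W x : Set G) := by
      simp [Subgroup.coe_inf, Subgroup.coe_iInf]
    rw [this]
    exact K₀.isOpen.inter (t.finite_toSet.isOpen_biInter fun x _ => hWo x)
  refine ⟨(K₀ : Subgroup G) ⊓ ⨅ x ∈ t, W x, hopen, ?_, fun k hk y => ?_⟩
  · exact hK₀.of_isClosed_subset (Subgroup.isClosed_of_isOpen _ hopen) fun g hg => hg.1
  · have hk' : ∀ x ∈ t, k ∈ W x := fun x hx =>
      (Subgroup.mem_iInf.1 ((Subgroup.mem_iInf.1 hk.2) x)) hx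
    by_cases hy : y ∈ ⋃ x ∈ t, (fun w => x * w) '' (W x : Set G)
    · obtain ⟨x, hx, w, hw, rfl⟩ : ∃ x ∈ t, ∃ w ∈ (W x : Set G), x * w = y := by
        simpa only [Set.mem_iUnion, Set.mem_image, exists_prop] using hy
      rw [mul_assoc, hWf x _ ((W x).mul_mem hw (hk' x hx)), hWf x _ hw]
    · have hy' : y * k ∉ ⋃ x ∈ t, (fun w => x * w) '' (W x : Set G) := by
        intro h
        apply hy
        obtain ⟨x, hx, w, hw, hxw⟩ : ∃ x ∈ t, ∃ w ∈ (W x : Set G), x * w = y * k := by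
          simpa only [Set.mem_iUnion, Set.mem_image, exists_prop] using h
        simp only [Set.mem_iUnion, Set.mem_image, exists_prop]
        refine ⟨x, hx, w * k⁻¹, (W x).mul_mem hw ((W x).inv_mem (hk' x hx)), ?_⟩
        rw [← mul_assoc, hxw, mul_inv_cancel_right]
      rw [image_eq_zero_of_notMem_tsupport (fun h => hy (ht h)),
        image_eq_zero_of_notMem_tsupport (fun h => hy' (ht h))]

omit [NonarchimedeanGroup G] [LocallyCompactSpace G] in
/-- Test functions are stable under inversion `f ↦ f(x⁻¹)`. [folklore] -/
lemma comp_inv_mem_schwartzBruhat [IsTopologicalGroup G] {f : G → ℂ} (hf : f ∈ SchwartzBruhat G) :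
    (fun x => f x⁻¹) ∈ SchwartzBruhat G :=
  ⟨hf.1.comp_continuous continuous_inv, hf.2.comp_homeomorph (Homeomorph.inv G)⟩

/-- **Uniform local constancy on both sides**: a test function on a locally compact
nonarchimedean group is bi-invariant under some compact open subgroup. [folklore] -/
theorem exists_isCompact_isOpen_forall_mul_eq {f : G → ℂ} (hf : f ∈ SchwartzBruhat G) :
    ∃ K : Subgroup G, IsOpen (K : Set G) ∧ IsCompact (K : Set G) ∧
      (∀ k ∈ K, ∀ x, f (x * k) = f x) ∧ (∀ k ∈ K, ∀ x, f (k * x) = f x) := by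
  obtain ⟨K₁, hK₁o, hK₁c, h₁⟩ := exists_isCompact_isOpen_forall_mul_right_eq hf
  obtain ⟨K₂, hK₂o, hK₂c, h₂⟩ :=
    exists_isCompact_isOpen_forall_mul_right_eq (comp_inv_mem_schwartzBruhat hf)
  refine ⟨K₁ ⊓ K₂, hK₁o.inter hK₂o,
    hK₁c.of_isClosed_subset (Subgroup.isClosed_of_isOpen _ (hK₁o.inter hK₂o)) fun g hg => hg.1,
    fun k hk x => h₁ k hk.1 x, fun k hk x => ?_⟩
  have := h₂ k⁻¹ (K₂.inv_mem hk.2) x⁻¹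
  simpa only [_root_.mul_inv_rev, inv_inv] using this

/-- Several test functions are simultaneously bi-invariant under one compact open subgroup.
[folklore] -/
theorem exists_isCompact_isOpen_forall_mul_eq₂ {f₁ f₂ : G → ℂ} (hf₁ : f₁ ∈ SchwartzBruhat G)
    (hf₂ : f₂ ∈ SchwartzBruhat G) :
    ∃ K : Subgroup G, IsOpen (K : Set G) ∧ IsCompact (K : Set G) ∧
      (∀ k ∈ K, ∀ x, f₁ (x * k) = f₁ x) ∧ (∀ k ∈ K, ∀ x, f₁ (k * x) = f₁ x) ∧
      (∀ k ∈ K, ∀ x, f₂ (x * k) = f₂ x) ∧ (∀ k ∈ K, ∀ x, f₂ (k * x) = f₂ x) := by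
  obtain ⟨K₁, hK₁o, hK₁c, h₁, h₁'⟩ := exists_isCompact_isOpen_forall_mul_eq hf₁
  obtain ⟨K₂, hK₂o, hK₂c, h₂, h₂'⟩ := exists_isCompact_isOpen_forall_mul_eq hf₂
  exact ⟨K₁ ⊓ K₂, hK₁o.inter hK₂o,
    hK₁c.of_isClosed_subset (Subgroup.isClosed_of_isOpen _ (hK₁o.inter hK₂o)) fun g hg => hg.1,
    fun k hk x => h₁ k hk.1 x, fun k hk x => h₁' k hk.1 x, fun k hk x => h₂ k hk.2 x,
    fun k hk x => h₂' k hk.2 x⟩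

omit [NonarchimedeanGroup G] [LocallyCompactSpace G] in
/-- **Finite coset decomposition of the support**: the support of a compactly supported
function meets only finitely many cosets `x K` of an open subgroup `K`. [folklore] -/
theorem exists_finset_quotient_of_hasCompactSupport [IsTopologicalGroup G] {f : G → ℂ}
    (hf : HasCompactSupport f) {K : Subgroup G} (hK : IsOpen (K : Set G)) :
    ∃ C : Finset (G ⧸ K), ∀ x, f x ≠ 0 → (x : G ⧸ K) ∈ C := by
  have hcov : tsupport f ⊆ ⋃ x : G, (fun k => x * k) '' (K : Set G) := fun x _ =>
    Set.mem_iUnion.2 ⟨x, 1, K.one_mem, mul_one x⟩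
  obtain ⟨t, ht⟩ := hf.elim_finite_subcover (fun x => (fun k => x * k) '' (K : Set G))
    (fun x => (isOpenMap_mul_left x) _ hK) hcov
  classical
  refine ⟨t.image (QuotientGroup.mk : G → G ⧸ K), fun x hx => ?_⟩
  obtain ⟨y, hy, k, hk, rfl⟩ : ∃ y ∈ t, ∃ k ∈ (K : Set G), y * k = x := by
    simpa only [Set.mem_iUnion, Set.mem_image, exists_prop] using ht (subset_tsupport _ hx)
  refine Finset.mem_image.2 ⟨y, hy, ?_⟩
  rw [QuotientGroup.eq, inv_mul_cancel_left]
  exact hk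

omit [NonarchimedeanGroup G] [LocallyCompactSpace G] in
/-- **Integration of a right-`K`-invariant test function as a finite sum over cosets**: if `f`
is right-invariant under the compact open subgroup `K` and its support meets only the cosets in
`C`, then for every right-`K`-invariant `Φ`,
`∫ f Φ dμ = μ(K) · ∑_{q ∈ C} f(q̃) Φ(q̃)` (`q̃` any representative). This is how a distribution
is evaluated on a convolution in Bump 1997, §4.4, pp. 458–459. (Any topological group: only the
continuity of left translations and the left invariance of `μ` are used.)
[cite: Bump1997, §4.4 pp. 458–459] -/
theorem integral_mul_eq_finset_sum [IsTopologicalGroup G] [MeasurableSpace G] [BorelSpace G]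
    (μ : Measure G) [μ.IsMulLeftInvariant] [IsFiniteMeasureOnCompacts μ] {f : G → ℂ}
    {K : Subgroup G} (hK : IsOpen (K : Set G)) (hKc : IsCompact (K : Set G))
    (hfK : ∀ k ∈ K, ∀ x, f (x * k) = f x) {C : Finset (G ⧸ K)}
    (hC : ∀ x, f x ≠ 0 → (x : G ⧸ K) ∈ C) {Φ : G → ℂ} (hΦ : ∀ k ∈ K, ∀ x, Φ (x * k) = Φ x) :
    ∫ x, f x * Φ x ∂μ = ∑ q ∈ C, (μ.real (K : Set G)) * (f q.out * Φ q.out) := by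
  classical
  -- pointwise: `f Φ = ∑_q (f q̃ Φ q̃) 1_{q̃ K}`
  have hpt : ∀ x, f x * Φ x =
      ∑ q ∈ C, ((fun y => (q.out : G)⁻¹ * y) ⁻¹' (K : Set G)).indicator
        (fun _ => f q.out * Φ q.out) x := by
    intro x
    have hmem : ∀ q : G ⧸ K, x ∈ (fun y => (q.out : G)⁻¹ * y) ⁻¹' (K : Set G) ↔ (x : G ⧸ K) = q := by
      intro q
      rw [Set.mem_preimage, SetLike.mem_coe, ← QuotientGroup.eq, QuotientGroup.out_eq', eq_comm]
    simp only [Set.indicator_apply, hmem, Finset.sum_ite_eq]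
    by_cases hx : (x : G ⧸ K) ∈ C
    · rw [if_pos hx]
      obtain ⟨k, hk⟩ := QuotientGroup.mk_out_eq_mul K x
      rw [hk, hfK _ k.2, hΦ _ k.2]
    · rw [if_neg hx]
      by_cases hfx : f x = 0
      · rw [hfx, zero_mul]
      · exact absurd (hC x hfx) hx
  have hmeas : ∀ q : G ⧸ K, MeasurableSet ((fun y => (q.out : G)⁻¹ * y) ⁻¹' (K : Set G)) :=
    fun q => (hK.preimage (continuous_const.mul continuous_id)).measurableSet
  have hμ : ∀ q : G ⧸ K, μ ((fun y => (q.out : G)⁻¹ * y) ⁻¹' (K : Set G)) = μ K := fun q =>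
    measure_preimage_mul μ _ _
  rw [show (fun x => f x * Φ x) = fun x => ∑ q ∈ C, ((fun y => (q.out : G)⁻¹ * y) ⁻¹'
      (K : Set G)).indicator (fun _ => f q.out * Φ q.out) x from funext hpt]
  rw [integral_finsetSum _ fun q _ => ?_]
  · refine Finset.sum_congr rfl fun q _ => ?_
    rw [integral_indicator_const _ (hmeas q), Complex.real_smul, measureReal_def, measureReal_def, hμ]
  · exact (integrable_indicator_iff (hmeas q)).2
      (integrableOn_const ((hμ q).trans_lt hKc.measure_lt_top).ne)

end Nonarchimedean

section HaarVolume

variable {G : Type*} [TopologicalSpace G] [Group G] [MeasurableSpace G]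

/-- A compact open subgroup has positive finite Haar volume. [folklore] -/
lemma measureReal_pos_of_isCompact_isOpen (μ : Measure G) [μ.IsOpenPosMeasure]
    [IsFiniteMeasureOnCompacts μ] {K : Subgroup G} (hKo : IsOpen (K : Set G))
    (hKc : IsCompact (K : Set G)) : 0 < μ.real (K : Set G) :=
  ENNReal.toReal_pos (hKo.measure_pos μ ⟨1, K.one_mem⟩).ne' hKc.measure_lt_top.ne

end HaarVolume


end Literature.NumberTheory.Automorphic

/-! ### The smeared functionals `Λ ⋆ φ` of a smooth representation (Bump 1997, (4.9)) -/

namespace Representation.IsSmooth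

open Literature.NumberTheory.Automorphic

variable {G : Type*} [TopologicalSpace G] [Group G] [IsTopologicalGroup G]
  {V : Type*} [AddCommGroup V] [Module ℂ V] {π : Representation ℂ G V}

/-- For a smooth vector `ξ`, a test function `φ` and any linear form `Λ`, the integrand
`g ↦ φ(g) Λ(π(g) ξ)` of Bump's (4.9) is a test function ("even if `Λ` is not smooth, the
integrand is smooth and compactly supported", Bump 1997, p. 458). [cite: Bump1997, (4.9), p. 458] -/
lemma mul_matrixCoeff_mem_schwartzBruhat (hπ : π.IsSmooth) (Λ : Module.Dual ℂ V)
    (φ : SchwartzBruhat G) (ξ : V) :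
    (fun g => (φ : G → ℂ) g * Λ (π g ξ)) ∈ SchwartzBruhat G :=
  ⟨φ.2.1.mul (π.isLocallyConstant_matrixCoeff Λ (hπ ξ)), φ.2.2.mul_right⟩

variable [MeasurableSpace G] [BorelSpace G]

/-- The integrand of Bump's (4.9) is integrable for a measure finite on compacts. [cite: Bump1997, (4.9), p. 458] -/
lemma integrable_mul_matrixCoeff (μ : Measure G) [IsFiniteMeasureOnCompacts μ] (hπ : π.IsSmooth)
    (Λ : Module.Dual ℂ V) (φ : SchwartzBruhat G) (ξ : V) :
    Integrable (fun g => (φ : G → ℂ) g * Λ (π g ξ)) μ :=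
  (mul_matrixCoeff_mem_schwartzBruhat hπ Λ φ ξ).1.continuous.integrable_of_hasCompactSupport
    (mul_matrixCoeff_mem_schwartzBruhat hπ Λ φ ξ).2

variable (μ : Measure G) [IsFiniteMeasureOnCompacts μ]

/-- **The smeared functional** `Λ ⋆ φ` of a linear form `Λ` on a smooth representation `(π, V)`
by a test function `φ`: `(Λ ⋆ φ)(ξ) = ∫_G φ(g) Λ(π(g) ξ) dg` (Bump 1997, (4.9), p. 458), as a
linear map in `φ` with values in linear forms on `V`. [cite: Bump1997, (4.9), p. 458] -/
noncomputable def smear (hπ : π.IsSmooth) (Λ : Module.Dual ℂ V) :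
    SchwartzBruhat G →ₗ[ℂ] Module.Dual ℂ V where
  toFun φ :=
    { toFun := fun ξ => ∫ g, (φ : G → ℂ) g * Λ (π g ξ) ∂μ
      map_add' := fun ξ η => by
        simp only [map_add, mul_add]
        exact integral_add (integrable_mul_matrixCoeff μ hπ Λ φ ξ)
          (integrable_mul_matrixCoeff μ hπ Λ φ η)
      map_smul' := fun c ξ => by
        simp only [map_smul, smul_eq_mul, RingHom.id_apply, ← integral_const_mul]
        congr 1
        funext g
        ring }
  map_add' φ₁ φ₂ := by
    ext ξ
    simp only [Submodule.coe_add, Pi.add_apply, add_mul, LinearMap.coe_mk, AddHom.coe_mk,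
      LinearMap.add_apply]
    exact integral_add (integrable_mul_matrixCoeff μ hπ Λ φ₁ ξ)
      (integrable_mul_matrixCoeff μ hπ Λ φ₂ ξ)
  map_smul' c φ := by
    ext ξ
    simp only [Submodule.coe_smul, Pi.smul_apply, smul_eq_mul, mul_assoc, LinearMap.coe_mk,
      AddHom.coe_mk, RingHom.id_apply, LinearMap.smul_apply, integral_const_mul]

/-- Unfolding lemma: `(Λ ⋆ φ)(ξ) = ∫ φ(g) Λ(π(g) ξ) dg`. [cite: Bump1997, (4.9), p. 458] -/
lemma smear_apply_apply (hπ : π.IsSmooth) (Λ : Module.Dual ℂ V)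
    (φ : SchwartzBruhat G) (ξ : V) :
    hπ.smear μ Λ φ ξ = ∫ g, (φ : G → ℂ) g * Λ (π g ξ) ∂μ := rfl

/-- **Translation of the argument** (the computation behind Bump's (4.10)): for a right invariant
measure, `(Λ ⋆ φ)(π(a) ξ) = (Λ ⋆ ρ(a⁻¹) φ)(ξ)`. [cite: Bump1997, (4.10), p. 458] -/
lemma smear_apply_apply_apply [μ.IsMulRightInvariant] (hπ : π.IsSmooth)
    (Λ : Module.Dual ℂ V) (φ : SchwartzBruhat G) (a : G) (ξ : V) :
    hπ.smear μ Λ φ (π a ξ) = hπ.smear μ Λ (SchwartzBruhat.rightTranslate a⁻¹ φ) ξ := by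
  rw [smear_apply_apply, smear_apply_apply]
  simp only [SchwartzBruhat.rightTranslate_apply]
  have h := integral_mul_right_eq_self (fun g => (φ : G → ℂ) (g * a⁻¹) * Λ (π g ξ)) a (μ := μ)
  simp only [mul_inv_cancel_right, map_mul, Module.End.mul_apply] at h
  exact h

/-- The dual action on a smeared functional is right translation of the test function:
`π^*(a)(Λ ⋆ φ) = Λ ⋆ ρ(a) φ`. [cite: Bump1997, (4.10), p. 458] -/
lemma dual_smear [μ.IsMulRightInvariant] (hπ : π.IsSmooth)
    (Λ : Module.Dual ℂ V) (φ : SchwartzBruhat G) (a : G) :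
    π.dual a (hπ.smear μ Λ φ) = hπ.smear μ Λ (SchwartzBruhat.rightTranslate a φ) := by
  ext ξ
  rw [Representation.dual_apply, Module.Dual.transpose_apply, LinearMap.comp_apply,
    hπ.smear_apply_apply_apply μ, inv_inv]

/-- **Smeared functionals are smooth** ("it is easy to see that `Λ ⋆ φ` is smooth", Bump 1997,
p. 458): `Λ ⋆ φ ∈ Ṽ`, its stabiliser containing the right stabiliser of `φ`.
[cite: Bump1997, §4.4, p. 458] -/
lemma smear_mem_contragredient [μ.IsMulRightInvariant] (hπ : π.IsSmooth)
    (Λ : Module.Dual ℂ V) (φ : SchwartzBruhat G) {K : Subgroup G} (hK : IsOpen (K : Set G))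
    (hφK : ∀ k ∈ K, ∀ x, (φ : G → ℂ) (x * k) = (φ : G → ℂ) x) :
    hπ.smear μ Λ φ ∈ π.contragredient := by
  rw [Representation.mem_contragredient]
  refine π.dual.isSmoothVector_of_le hK fun k hk => ?_
  rw [Representation.mem_stabilizerSubgroup, hπ.dual_smear μ]
  congr 1
  apply Subtype.ext
  funext x
  exact hφK k hk x

/-- **Left equivariance** (Bump's (4.12)): if `Λ(π(u) v) = c Λ(v)` for all `v`, then
`Λ ⋆ λ(u) φ = c (Λ ⋆ φ)`, by left invariance of the measure. [cite: Bump1997, (4.12), p. 458] -/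
lemma smear_leftTranslate [μ.IsMulLeftInvariant] (hπ : π.IsSmooth)
    {Λ : Module.Dual ℂ V} {u : G} {c : ℂ} (hΛ : ∀ v, Λ (π u v) = c * Λ v)
    (φ : SchwartzBruhat G) :
    hπ.smear μ Λ (SchwartzBruhat.leftTranslate u φ) = c • hπ.smear μ Λ φ := by
  ext ξ
  rw [LinearMap.smul_apply, smear_apply_apply, smear_apply_apply, smul_eq_mul,
    ← integral_const_mul]
  simp only [SchwartzBruhat.leftTranslate_apply]
  have h := integral_mul_left_eq_self (fun g => (φ : G → ℂ) (u⁻¹ * g) * Λ (π g ξ)) u (μ := μ)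
  simp only [inv_mul_cancel_left, map_mul, Module.End.mul_apply, hΛ] at h
  rw [← h]
  congr 1
  funext g
  ring

/-- If `Λ ⋆ φ = 0` then `Λ ⋆ ρ(a) φ = 0` for every `a` (first step of Bump's Lemma 4.4.1).
[cite: Bump1997, Lemma 4.4.1, p. 459] -/
lemma smear_rightTranslate_eq_zero [μ.IsMulRightInvariant]
    (hπ : π.IsSmooth) {Λ : Module.Dual ℂ V} {φ : SchwartzBruhat G} (h : hπ.smear μ Λ φ = 0)
    (a : G) : hπ.smear μ Λ (SchwartzBruhat.rightTranslate a φ) = 0 := by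
  rw [← hπ.dual_smear μ, h, map_zero]

omit [MeasurableSpace G] [BorelSpace G] in
/-- The indicator function of a compact open subgroup is a test function. [folklore] -/
lemma _root_.Literature.NumberTheory.Automorphic.indicator_mem_schwartzBruhat {K : Subgroup G} (hK : IsOpen (K : Set G))
    (hKc : IsCompact (K : Set G)) :
    (K : Set G).indicator (fun _ => (1 : ℂ)) ∈ SchwartzBruhat G := by
  refine ⟨(IsLocallyConstant.iff_exists_open _).2 fun x => ?_,
    HasCompactSupport.intro hKc fun x hx => Set.indicator_of_notMem hx _⟩
  by_cases hx : x ∈ (K : Set G)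
  · exact ⟨K, hK, hx, fun y hy => by rw [Set.indicator_of_mem hy, Set.indicator_of_mem hx]⟩
  · refine ⟨(K : Set G)ᶜ, (K.isClosed_of_isOpen hK).isOpen_compl, hx, fun y hy => ?_⟩
    rw [Set.indicator_of_notMem hy, Set.indicator_of_notMem hx]

/-- **The bump-function computation** (Bump 1997, p. 459: "let `φ` be the characteristic
function of a small neighbourhood … then `(Λ ⋆ φ)(ξ) = Λ(ξ)`", up to the volume): if the
compact open subgroup `K` fixes `ξ`, then `(Λ ⋆ 1_K)(ξ) = μ(K) Λ(ξ)`. [cite: Bump1997, §4.4, p. 459] -/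
lemma smear_indicator_apply (hπ : π.IsSmooth) (Λ : Module.Dual ℂ V)
    {K : Subgroup G} (hK : IsOpen (K : Set G)) (hKc : IsCompact (K : Set G)) {ξ : V}
    (hξ : ∀ k ∈ K, π k ξ = ξ) :
    hπ.smear μ Λ ⟨_, indicator_mem_schwartzBruhat hK hKc⟩ ξ = (μ.real (K : Set G) : ℂ) * Λ ξ := by
  rw [smear_apply_apply]
  have : (fun g => (K : Set G).indicator (fun _ => (1 : ℂ)) g * Λ (π g ξ)) =
      (K : Set G).indicator fun _ => Λ ξ := by
    funext g
    by_cases hg : g ∈ (K : Set G)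
    · rw [Set.indicator_of_mem hg, Set.indicator_of_mem hg, one_mul, hξ g hg]
    · rw [Set.indicator_of_notMem hg, Set.indicator_of_notMem hg, zero_mul]
  simp only [this, integral_indicator_const _ hK.measurableSet, Complex.real_smul]

end Representation.IsSmooth
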